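import Literature.Probability.RandomPlanarGeometry.RestrictionUniqueness
import Literature.Probability.RandomPlanarGeometry.HullApproximationProofs
import Literature.Probability.RandomPlanarGeometry.HullRestrictionSLE
import Literature.Probability.RandomPlanarGeometry.ConformalMapCaratheodoryProofs
import Literature.Topology.PlaneTopology.JordanCurveProofs

/-!
# Crux `SAWDevelopingMap.ObservableToSLE` (stmt-CriticalPhenomena-10472), line
`floor-ratio-restriction-bootstrap`, stub `stub_restrictionIdentifies`: half-plane hull lemmas

Landing target:
`Summits/CriticalPhenomena/SAWScalingLimit/Theorems/SAWDevelopingMapObservableToSLERestrictionIdentifiesHulls.lean`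
(`--supports stmt-CriticalPhenomena-10472`).

Deterministic (measure-free) half-plane and Dobrushin-domain lemmas for the LSW closing step
`stub_restrictionIdentifies`, which identifies a subsequential limit law `μ` of the critical
hexagonal SAW from the limits `d^{5/8}` of the lattice hull-avoidance probabilities over the Jordan
hull subdomains `D'` of `D`:

* `avoid_eq_iUnion_avoid_of_squeeze`, `measure_avoid_eq_iSup_of_squeeze` — **outer continuity of
  avoidance**: if `*`-hulls
  `A_k ↓` squeeze a set `B` (`B ∩ ℍ ⊆ A_k`, `(⋂ A_k) ∩ ℍ ⊆ B`, `0 ∉ A_0`), a configuration of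
  [LSW]'s `Ω` avoids `B` iff it avoids some `A_k` (compactness), so that avoidance probabilities
  of `B` are increasing limits of those of the `A_k` for EVERY law on `Ω`;
* `isPlusHull_hpFill_of_pos` — the fill of a test set all of whose real points are positive is a
  `+`-hull as soon as it is a `*`-hull (a strip over `[y, 0]` joins a negative real point of the
  fill to `0`);
* `stub_restrictionIdentifies_plusApprox` — **every nonempty `+`-hull `B ∌ 0` is squeezed by the
  pulled-back hulls of a decreasing sequence of Jordan hull subdomains with `B ∩ ℍ` INTERIOR to each
  of them**: the smooth hulls `E_δ ⊇ A` of [LSW] Lemma 2.1 (`IsPlusHull.arcHull`: antitone,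
  `⋂ = realFill`, `A ∩ ℍ ⊆ interior`, `HullApproximationProofs`) are pull-backs of Jordan hull
  subdomains (`exists_isHullSubdomain_pullbackHull_eq`, `ArcHullDomains`);
* the dictionary between the D-side events of the sandwich and avoidance in `ℍ`
  (`isClosed_image_pullbackHull`, `diff_subset_image_pullbackHull`, `closure_diff_subset`,
  `disjoint_pullbackTrace_of_rangeSubset_closure`);
* `biUnion_plusTest` — finite unions of `+`-anchored rational test sets are `+`-anchored or empty.
-/

noncomputable section

open scoped Topology NNReal ENNReal Classical
open Filter Set MeasureTheory Metric
open Literature.Probability.RandomPlanarGeometry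
open UpperHalfPlane (upperHalfPlaneSet isOpen_upperHalfPlaneSet)

namespace Summit.CriticalPhenomena.SAWScalingLimit.Theorems.ObservableToSLE.FloorRatio

/-! ### Outer continuity of avoidance events on `Ω` -/

/-- **Outer continuity of avoidance.**  Let `A_k` be a decreasing sequence of closed sets with `A_0`
compact and `0 ∉ A_0`, squeezing `B`: `B ∩ ℍ ⊆ A_k` for all `k` and `(⋂ A_k) ∩ ℍ ⊆ B`.  Then a
configuration of `Ω` avoids `B` iff it avoids some `A_k`: `{K ∩ B = ∅} = ⋃ₖ {K ∩ A_k = ∅}` (the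
compact sets `cl K ∩ A_k` decrease to `cl K ∩ ⋂ A_k ⊆ (K ∩ B) ∪ ({0} ∩ A_0) = ∅`). [folklore] -/
theorem avoid_eq_iUnion_avoid_of_squeeze {B : Set ℂ} {A : ℕ → Set ℂ} (hA : Antitone A)
    (hAc : ∀ k, IsClosed (A k)) (hA0 : IsCompact (A 0)) (h0 : (0 : ℂ) ∉ A 0)
    (hsub : ∀ k, B ∩ upperHalfPlaneSet ⊆ A k) (hint : (⋂ k, A k) ∩ upperHalfPlaneSet ⊆ B) :
    RestrictionConfig.avoid B = ⋃ k, RestrictionConfig.avoid (A k) := by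
  ext K
  simp only [RestrictionConfig.mem_avoid, mem_iUnion]
  constructor
  · intro hKB
    set s : Set ℂ := closure (K : Set ℂ) ∩ A 0 with hs
    have hsc : IsCompact s := hA0.inter_left isClosed_closure
    have hempty : s ∩ ⋂ k, A k = ∅ := by
      refine Set.eq_empty_of_forall_notMem fun z ⟨⟨hzK, hzA0⟩, hzA⟩ => ?_
      rcases K.closure_subset hzK with hz | hz
      · have hzB : z ∈ B := hint ⟨hzA, K.subset_upperHalfPlaneSet hz⟩
        exact Set.disjoint_left.1 hKB hz hzB
      · rw [mem_singleton_iff] at hz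
        exact h0 (hz ▸ hzA0)
    obtain ⟨k, hk⟩ := hsc.elim_directed_family_closed A hAc hempty
      (directed_of_isDirected_le fun i j hij => hA hij)
    refine ⟨k, Set.disjoint_left.2 fun z hzK hzA => ?_⟩
    have : z ∈ s ∩ A k := ⟨⟨subset_closure hzK, hA (Nat.zero_le k) hzA⟩, hzA⟩
    rw [hk] at this
    exact this
  · rintro ⟨k, hk⟩
    exact Set.disjoint_left.2 fun z hzK hzB =>
      Set.disjoint_left.1 hk hzK (hsub k ⟨hzB, K.subset_upperHalfPlaneSet hzK⟩)

/-- The avoidance events of a decreasing family increase. [folklore] -/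
theorem monotone_avoid_of_antitone {A : ℕ → Set ℂ} (hA : Antitone A) :
    Monotone fun k => RestrictionConfig.avoid (A k) :=
  fun _ _ hkl _ hK => Set.disjoint_left.2 fun _ hzK hzA => Set.disjoint_left.1 hK hzK (hA hkl hzA)

/-- **Avoidance probabilities are increasing limits along a squeezing family**, for every measure
on `Ω`. [folklore] -/
theorem measure_avoid_eq_iSup_of_squeeze (P : Measure RestrictionConfig) {B : Set ℂ}
    {A : ℕ → Set ℂ} (hA : Antitone A) (hAc : ∀ k, IsClosed (A k)) (hA0 : IsCompact (A 0))
    (h0 : (0 : ℂ) ∉ A 0) (hsub : ∀ k, B ∩ upperHalfPlaneSet ⊆ A k)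
    (hint : (⋂ k, A k) ∩ upperHalfPlaneSet ⊆ B) :
    P (RestrictionConfig.avoid B) = ⨆ k, P (RestrictionConfig.avoid (A k)) := by
  rw [avoid_eq_iUnion_avoid_of_squeeze hA hAc hA0 h0 hsub hint]
  exact (monotone_avoid_of_antitone hA).measure_iUnion

/-! ### Fills of `+`-sided test sets are `+`-hulls -/

/-- **The fill of a `+`-sided set is a `+`-hull** as soon as it is a `*`-hull: if every real point
of the closed bounded set `T` is positive, every real point of `hpFill T` is positive.  A real
point `y < 0` of the fill would be approached by points of bounded components of `ℍ ∖ T`; the open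
box over `[y - 1, 0]` of small height misses `T` and is connected, so all its points lie in bounded
components, and they accumulate at `0`, forcing `0 ∈ hpFill T`. [folklore] -/
theorem isPlusHull_hpFill_of_pos {T : Set ℂ} (hTc : IsClosed T)
    (hpos : ∀ x : ℝ, (x : ℂ) ∈ T → 0 < x) (hT : IsStarHull (hpFill T)) : IsPlusHull (hpFill T) := by
  refine ⟨hT, fun y hy => ?_⟩
  by_contra hy0
  push Not at hy0
  rcases hy0.lt_or_eq with hyneg | hyzero
  swap
  · exact hT.2 (by rw [← Complex.ofReal_zero, ← hyzero]; exact hy)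
  -- the unbounded component and the fill
  set U : Set ℂ := upperHalfPlaneSet \ T with hU
  set V : Set ℂ := Loewner.unboundedComponent U with hV
  have hfill : hpFill T = closure (upperHalfPlaneSet \ V) := rfl
  -- a strip over `[y - 1, 0]` free of `T`
  set K₀ : Set ℂ := ((↑) : ℝ → ℂ) '' Icc (y - 1) 0 with hK₀
  have hK₀c : IsCompact K₀ := isCompact_Icc.image Complex.continuous_ofReal
  have hK₀T : K₀ ⊆ Tᶜ := by
    rintro _ ⟨x, hx, rfl⟩ hxT
    have := hpos x hxT
    linarith [hx.2]
  obtain ⟨h, hh, hthick⟩ := hK₀c.exists_thickening_subset_open hTc.isOpen_compl hK₀T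
  have hfree : ∀ z : ℂ, y - 1 ≤ z.re → z.re ≤ 0 → 0 ≤ z.im → z.im < h → z ∉ T := by
    intro z h1 h2 h3 h4 hzT
    have hzK : z ∈ Metric.thickening h K₀ := by
      rw [Metric.mem_thickening_iff]
      refine ⟨(z.re : ℂ), ⟨z.re, ⟨h1, h2⟩, rfl⟩, ?_⟩
      rw [Complex.dist_of_re_eq (by simp)]
      simpa [abs_of_nonneg h3] using h4
    exact hthick hzK hzT
  -- the open box `N`
  set N : Set ℂ := {z : ℂ | y - 1 < z.re} ∩ {z : ℂ | z.re < 0} ∩ {z : ℂ | 0 < z.im} ∩ {z : ℂ | z.im < h}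
    with hN
  have hNconv : Convex ℝ N :=
    (((convex_halfSpace_re_gt _).inter (convex_halfSpace_re_lt _)).inter
      (convex_halfSpace_im_gt _)).inter (convex_halfSpace_im_lt _)
  have hNU : N ⊆ U := fun z ⟨⟨⟨h1, h2⟩, h3⟩, h4⟩ =>
    ⟨h3, hfree z h1.le h2.le h3.le h4⟩
  -- a point `w ∈ N` off the unbounded component
  have hycl : (y : ℂ) ∈ closure (upperHalfPlaneSet \ V) := hfill ▸ hy
  set r : ℝ := min h (min 1 (-y)) with hr
  have hr0 : 0 < r := lt_min hh (lt_min one_pos (by linarith))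
  obtain ⟨w, hwy, hwV⟩ := Metric.mem_closure_iff.1 hycl r hr0
  have hwV' : ‖w - y‖ < r := by rwa [dist_comm, dist_eq_norm] at hwV
  have hwre : |w.re - y| < r := by
    have := Complex.abs_re_le_norm (w - y)
    rw [Complex.sub_re, Complex.ofReal_re] at this
    exact this.trans_lt hwV'
  have hwim : w.im < r := by
    have := Complex.abs_im_le_norm (w - y)
    rw [Complex.sub_im, Complex.ofReal_im, sub_zero] at this
    exact (le_abs_self _).trans_lt (this.trans_lt hwV')
  have hrh : r ≤ h := min_le_left _ _
  have hr1 : r ≤ 1 := (min_le_right _ _).trans (min_le_left _ _)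
  have hry : r ≤ -y := (min_le_right _ _).trans (min_le_right _ _)
  obtain ⟨hwre1, hwre2⟩ := abs_lt.1 hwre
  have hwN : w ∈ N := by
    refine ⟨⟨⟨?_, ?_⟩, hwy.1⟩, hwim.trans_le hrh⟩
    · show y - 1 < w.re
      linarith
    · show w.re < 0
      linarith
  -- every point of `N` is off the unbounded component
  have hbdd : Bornology.IsBounded (connectedComponentIn U w) := by
    by_contra hnb
    exact hwy.2 ⟨hNU hwN, hnb⟩
  have hNV : ∀ w' ∈ N, w' ∈ upperHalfPlaneSet \ V := by
    intro w' hw'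
    refine ⟨(hNU hw').1, fun hw'V => hw'V.2 ?_⟩
    have hmem : w' ∈ connectedComponentIn U w :=
      hNconv.isPreconnected.subset_connectedComponentIn hwN hNU hw'
    rw [← connectedComponentIn_eq hmem]
    exact hbdd
  -- hence `0 ∈ hpFill T`
  refine hT.2 ?_
  rw [hfill, Metric.mem_closure_iff]
  intro ε hε
  set t : ℝ := min (ε / 4) (r / 2) with ht
  have ht0 : 0 < t := lt_min (by positivity) (by positivity)
  have htε : t ≤ ε / 4 := min_le_left _ _
  have htr : t ≤ r / 2 := min_le_right _ _
  have ht1 : t < 1 - y := by linarith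
  have hth : t < h := by linarith
  refine ⟨⟨-t, t⟩, hNV _ ⟨⟨⟨?_, ?_⟩, ?_⟩, ?_⟩, ?_⟩
  · show y - 1 < -t
    linarith
  · show -t < 0
    linarith
  · show 0 < t
    exact ht0
  · show t < h
    exact hth
  · rw [dist_comm, Complex.dist_eq, sub_zero, Complex.norm_def, Complex.normSq_mk]
    calc Real.sqrt (-t * -t + t * t) = Real.sqrt (t ^ 2 * 2) := by ring_nf
      _ ≤ Real.sqrt ((2 * t) ^ 2) := Real.sqrt_le_sqrt (by nlinarith)
      _ = 2 * t := Real.sqrt_sq (by positivity)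
      _ < ε := by linarith

/-! ### Strict outer approximation of `+`-hulls by pull-backs of Jordan hull subdomains -/

/-- **Registered sub-goal `stub_restrictionIdentifies_plusApprox`** (crux item
stmt-CriticalPhenomena-10472, line `floor-ratio-restriction-bootstrap`, stub
`stub_restrictionIdentifies`): every nonempty `+`-hull `B` is squeezed, under any chordal
uniformizing map `φ` of a Dobrushin domain `D`, by the pulled-back hulls
`A_k = cl(ℍ ∖ φ⁻¹ D_k)` of a DECREASING sequence of Jordan hull subdomains `D_k` of `D`, with
`B ∩ ℍ` interior to every `A_k` and `(⋂ A_k) ∩ ℍ ⊆ B`.  The `A_k` are the smooth hulls `E_{δ_k}(B)` of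
[LSW] Lemma 2.1 (`IsPlusHull.arcHull`; antitone, `⋂ₖ E_{δ_k} = realFill B`, points of `B ∩ ℍ` are
interior), which are pull-backs of Jordan hull subdomains (`exists_isHullSubdomain_pullbackHull_eq`,
Jordan curve theorem and Carathéodory).
[cite: LawlerSchrammWerner2003Restriction, Lemma 2.1 and its proof (p. 8); proof of Lemma 3.5 (p. 13, the hulls E_δ)] -/
theorem stub_restrictionIdentifies_plusApprox :
    ∀ (D : DobrushinDomain) (φ : ConformalEquiv upperHalfPlaneSet D.carrier) (B : Set ℂ),
    D.IsChordalUniformizing φ → IsPlusHull B → B.Nonempty →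
    ∃ Dk : ℕ → DobrushinDomain, (∀ k, D.IsHullSubdomain (Dk k)) ∧
      Antitone (fun k => φ.pullbackHull (Dk k)) ∧
      (∀ k, B ∩ upperHalfPlaneSet ⊆ interior (φ.pullbackHull (Dk k))) ∧
      (⋂ k, φ.pullbackHull (Dk k)) ∩ upperHalfPlaneSet ⊆ B := by
  intro D φ B hφ hB hne
  have hJCT := Literature.Topology.PlaneTopology.JordanCurveTheorem_holds
  have hC : JordanDomain.exists_continuousOn_extension := JordanDomain.exists_continuousOn_extension_holds
  choose Dk hDk hDkeq using fun k =>
    exists_isHullSubdomain_pullbackHull_eq hJCT hC hφ (hB.isArcHull_arcHull hne k)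
      (hB.isStarHull_arcHull hne k).2
  refine ⟨Dk, hDk, ?_, fun k => ?_, ?_⟩
  · intro k l hkl
    simp only [hDkeq]
    exact hB.antitone_arcHull hne hkl
  · rintro z ⟨hzB, hz⟩
    rw [hDkeq]
    exact hB.mem_interior_arcHull hne k hzB hz
  · have : (⋂ k, φ.pullbackHull (Dk k)) = ⋂ k, hB.arcHull hne k := iInter_congr hDkeq
    rw [this, hB.iInter_arcHull hne]
    exact (realFill_inter_upperHalfPlaneSet_subset B)

/-! ### The dictionary: D-side events of the sandwich versus avoidance in `ℍ` -/

section Dictionary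

variable {D D' : DobrushinDomain} {φ : ConformalEquiv upperHalfPlaneSet D.carrier}

/-- The image of a pulled-back hull under the boundary extension is closed (compact). [folklore] -/
theorem isClosed_image_pullbackHull (hsc : ∀ D : JordanDomain, D.isSimplyConnected)
    (hC : JordanDomain.exists_continuousOn_extension) (hφ : D.IsChordalUniformizing φ)
    (hD' : D.IsHullSubdomain D') : IsClosed (φ.boundaryExtension '' φ.pullbackHull D') :=
  have hA := IsStarHull.pullbackHull hsc hφ hD'
  (MarkedDomain.isCompact_image_boundaryExtension hC hA.1.subset_closure hA.1.isCompact).isClosed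

/-- **`D ∖ D' ⊆ φ̂(A)`** for the pulled-back hull `A` of `D'`. [folklore] -/
theorem diff_subset_image_pullbackHull :
    D.carrier \ D'.carrier ⊆ φ.boundaryExtension '' φ.pullbackHull D' := by
  rintro w ⟨hwD, hwD'⟩
  have hz : φ.symm w ∈ upperHalfPlaneSet := φ.symm_mapsTo hwD
  refine ⟨φ.symm w, ?_, ?_⟩
  · by_contra hzA
    have := (notMem_pullbackHull_iff (φ := φ) (D' := D') hz).1 hzA
    rw [φ.apply_symm_apply hwD] at this
    exact hwD' this
  · rw [φ.boundaryExtension_eq hz, φ.apply_symm_apply hwD]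

/-- **`cl D ∖ S ⊆ cl D'`** whenever the closed set `S` contains `D ∖ D'` (and `D' ⊆ D`). [folklore] -/
theorem closure_diff_subset {S : Set ℂ} (hS : IsClosed S) (h1 : D.carrier \ D'.carrier ⊆ S) :
    closure D.carrier \ S ⊆ closure D'.carrier := by
  rintro z ⟨hz, hzS⟩
  have hD : D.carrier ⊆ D'.carrier ∪ (D.carrier \ D'.carrier) := fun v hv => by
    by_cases h : v ∈ D'.carrier
    · exact Or.inl h
    · exact Or.inr ⟨hv, h⟩
  replace hz := closure_mono hD hz
  rw [closure_union] at hz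
  rcases hz with hz | hz
  · exact hz
  · exact absurd (hS.closure_subset_iff.2 h1 hz) hzS

/-- Interior points of `cl(T ∖ P)` are not in the closure of the open set `P`. [folklore] -/
theorem not_mem_closure_of_mem_interior_closure_diff {P T : Set ℂ} (hP : IsOpen P) {z : ℂ}
    (hz' : z ∈ interior (closure (T \ P))) (hz : z ∈ closure P) : False := by
  rw [mem_interior_iff_mem_nhds] at hz'
  rw [mem_closure_iff_nhds] at hz
  obtain ⟨w, hw, hwP⟩ := hz _ hz'
  have hwcl : w ∈ closure (T \ P) := hw
  rw [mem_closure_iff_nhds] at hwcl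
  obtain ⟨v, hvP, hv⟩ := hwcl P (hP.mem_nhds hwP)
  exact hv.2 hvP

/-- **On `{curve ⊆ cl D'}`, the pulled-back trace of a chordal curve avoids every set whose
`ℍ`-part is interior to the pulled-back hull of `D'`**: the pulled-back trace lies in
`cl(φ⁻¹ D')`, which misses the interior of `A = cl(ℍ ∖ φ⁻¹ D')`. [folklore] -/
theorem disjoint_pullbackTrace_of_rangeSubset_closure (hD' : D.IsHullSubdomain D') {B : Set ℂ}
    (hB : B ∩ upperHalfPlaneSet ⊆ interior (φ.pullbackHull D')) {c : CurveClass ℂ}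
    (hV : c ∈ CurveClass.rangeSubset (closure D'.carrier)) :
    Disjoint (φ.pullbackTrace c) B := by
  refine Set.disjoint_left.2 ?_
  rintro _ ⟨w, ⟨hw, hwD⟩, rfl⟩ hzB
  have hz : φ.symm w ∈ upperHalfPlaneSet := φ.symm_mapsTo hwD
  have hcl : φ.symm w ∈ closure (φ.pullbackDomain D') :=
    ConformalEquiv.mem_closure_pullbackDomain_of_apply hz hD'.carrier_subset
      (by rw [φ.apply_symm_apply hwD]; exact hV hw)
  exact not_mem_closure_of_mem_interior_closure_diff ConformalEquiv.isOpen_pullbackDomain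
    (hB ⟨hzB, hz⟩) hcl

end Dictionary

/-! ### Finite unions of `+`-anchored rational test sets -/

/-- **Finite unions of `+`-anchored test sets are `+`-anchored or empty**, compact, in `ℍ̄`, off
`0`.  Here `C n` is a sequence each of whose terms is a rational test set which is either
`+`-anchored (anchored with positive real points) or given by the empty list. [folklore] -/
theorem biUnion_plusTest {C : ℕ → Set ℂ}
    (hC : ∀ n, ∃ l : List (ℚ × ℚ × ℚ), C n = testSet l ∧
      ((IsAnchored (testSet l) ∧ ∀ x : ℝ, (x : ℂ) ∈ testSet l → 0 < x) ∨ l = []))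
    (s : Finset ℕ) :
    ((⋃ n ∈ s, C n) = ∅ ∨
      (IsAnchored (⋃ n ∈ s, C n) ∧ ∀ x : ℝ, (x : ℂ) ∈ (⋃ n ∈ s, C n) → 0 < x)) ∧
      IsCompact (⋃ n ∈ s, C n) ∧ (⋃ n ∈ s, C n) ⊆ closure upperHalfPlaneSet ∧
      (0 : ℂ) ∉ ⋃ n ∈ s, C n := by
  classical
  have hcpt : ∀ n, IsCompact (C n) := fun n => by
    obtain ⟨l, hl, -⟩ := hC n
    rw [hl]; exact isCompact_testSet l
  have hcl : ∀ n, C n ⊆ closure upperHalfPlaneSet := fun n => by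
    obtain ⟨l, hl, -⟩ := hC n
    rw [hl]; exact testSet_subset_closure l
  have hcase : ∀ n, C n = ∅ ∨ (IsAnchored (C n) ∧ ∀ x : ℝ, (x : ℂ) ∈ C n → 0 < x) := fun n => by
    obtain ⟨l, hl, h | h⟩ := hC n
    · exact Or.inr (by rw [hl]; exact h)
    · left; rw [hl, h, testSet_nil]
  refine ⟨?_, s.finite_toSet.isCompact_biUnion fun n _ => hcpt n,
    iUnion₂_subset fun n _ => hcl n, ?_⟩
  · induction s using Finset.induction_on with
    | empty => left; simp
    | insert a s ha ih =>
      rw [Finset.set_biUnion_insert]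
      rcases hcase a with h0 | hA
      · rw [h0, empty_union]; exact ih
      · rcases ih with h0' | hA'
        · rw [h0', union_empty]; exact Or.inr hA
        · refine Or.inr ⟨hA.1.union hA'.1, fun x hx => ?_⟩
          rcases hx with hx | hx
          · exact hA.2 x hx
          · exact hA'.2 x hx
  · simp only [mem_iUnion, exists_prop, not_exists, not_and]
    intro n _ h0
    rcases hcase n with h | h
    · rw [h] at h0; exact h0
    · exact h.1.1 h0

end Summit.CriticalPhenomena.SAWScalingLimit.Theorems.ObservableToSLE.FloorRatio

end
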